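import Summits.NavierStokesRegularity.NavierStokesRegularity.Theses.AdaptedFrequency
import Literature.Analysis.FluidPDE.AdaptedBackwardKernel
import Literature.Analysis.FluidPDE.ClassicalSolution
import Summits.NavierStokesRegularity.NavierStokesRegularity.Theorems.AdaptedFrequencyAdaptedFrequencyConvergesStubBlockSolverLimit

/-!
# Crux `AdaptedFrequencyConverges` (stmt-NavierStokesRegularity-10493), line
  `cloud-frame-effective-tsai`: STUB `stub_blockSolver` — the backward block solver

Lands `--supports stmt-NavierStokesRegularity-10493` the registered stub `stub_blockSolver` of the
lead's skeleton `Cruxes/AdaptedFrequencyConverges/Lines/cloud_frame_effective_tsai.lean`: the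
linear backward drift–diffusion equation `∂ₜW + b·∇W + νΔW = 0` with a smooth, bounded,
divergence-free drift on a neighbourhood `[s₀, s₁] ⊃ [s, s′]` of the block and smooth compactly
supported nonnegative terminal data `f` at `s′` has a classical solution on `[s, s′) × ℝ³`
which is nonnegative, has a Gaussian envelope centred at `0`, and attains `f` uniformly as
`t ↑ s′`.

Proof: `blockSolver_limit` (file `…StubBlockSolverLimit`: Lions' `L²` corrector of the backward
caloric extension `F = e^{ν(s′−t)Δ}f` for a drift cut off near `s′`, Hörmander hypoellipticity,
positivity / envelope / terminal layer by the comparison principle, passage to the limit in the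
cut-off) on the open slab `Ioo ((s₀+s)/2) s′`, restricted to `Ico s s′`: the two-sided time
derivative is the one-sided `timeDerivWithin (Ico s s′)` there, and the terminal attainment is
`|W − f| ≤ |W − F| + |F − f| ≤ (M + 3C₂ν)(s′ − t)` (`caloric_abs_sub_data_le`).
-/

noncomputable section

namespace Summit.NavierStokesRegularity.NavierStokesRegularity.Theorems.AdaptedFrequencyConverges.CloudFrameEffectiveTsai

open scoped Topology Laplacian
open Literature.Analysis.FluidPDE Set Filter MeasureTheory Function
open Literature.Analysis.UnboundedOperators

/-- **STUB `stub_blockSolver` — the backward block solver** (middle third of kernel uniqueness;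
card lever 1): the linear backward drift–diffusion equation `∂ₜW + b·∇W + νΔW = 0` with a
smooth, bounded, divergence-free drift on `[s, s′]` and smooth compactly supported nonnegative
terminal data `f` at `s′`, has a classical solution on `[s, s′) × ℝ³` which is nonnegative, has a
Gaussian envelope, and attains `f` uniformly as `t ↑ s′` (Lions corrector + hypoellipticity;
positivity and envelope by comparison; passage to the limit in a terminal cut-off of the drift). -/
theorem stub_blockSolver :
    ∀ (ν B s₀ s s' s₁ : ℝ) (b : ℝ → (EuclideanSpace ℝ (Fin 3)) → (EuclideanSpace ℝ (Fin 3))) (f : (EuclideanSpace ℝ (Fin 3)) → ℝ), 0 < ν → 0 ≤ B → s₀ < s → s < s' → s' < s₁ → IsSmoothSpaceTimeOn (Icc s₀ s₁) b → (∀ τ ∈ Icc s₀ s₁, VectorCalculus.IsDivFree (b τ)) → (∀ τ ∈ Icc s₀ s₁, ∀ x, ‖b τ x‖ ≤ B) → ContDiff ℝ (⊤ : ℕ∞) f → HasCompactSupport f → (∀ x, 0 ≤ f x) → ∃ W : ℝ → (EuclideanSpace ℝ (Fin 3)) → ℝ, ContDiffOn ℝ 2 (uncurry W) (Ico s s' ×ˢ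 univ) ∧ (∀ τ ∈ Ico s s', ∀ x, timeDerivWithin (Ico s s') W τ x + fderiv ℝ (W τ) x (b τ x) + ν * Laplacian.laplacian (W τ) x = 0) ∧ (∀ τ ∈ Ico s s', ∀ x, 0 ≤ W τ x) ∧ (∃ A a : ℝ, 0 < a ∧ ∀ τ ∈ Ico s s', ∀ x, W τ x ≤ A * Real.exp (-‖x‖ ^ 2 / a)) ∧ (∀ ε : ℝ, 0 < ε → ∃ s₂ ∈ Ico s s', ∀ τ ∈ Ico s₂ s', ∀ x, |W τ x - f x| ≤ ε) := by
  intro ν B s₀ s s' s₁ b f hν hB hs₀ hss' hs₁ hsm hdiv hBd hf hfc hf0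
  -- the slab `Ico s₀ s'` and the middle level `tₘ`
  set tₘ : ℝ := (s₀ + s) / 2 with htₘ_def
  have h₀ₘ : s₀ < tₘ := by rw [htₘ_def]; linarith
  have hₘs : tₘ < s := by rw [htₘ_def]; linarith
  have hₘs' : tₘ < s' := hₘs.trans hss'
  have hsub : Ico s₀ s' ⊆ Icc s₀ s₁ := fun t ht => ⟨ht.1, ht.2.le.trans hs₁.le⟩
  have hsm' : IsSmoothSpaceTimeOn (Ico s₀ s') b := hsm.mono hsub
  have hdiv' : ∀ t ∈ Ico s₀ s', VectorCalculus.IsDivFree (b t) := fun t ht => hdiv t (hsub ht)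
  have hBd' : ∀ t ∈ Ico s₀ s', ∀ x, ‖b t x‖ ≤ B := fun t ht x => hBd t (hsub ht) x
  have hf2 : ContDiff ℝ 2 f := hf.of_le (by norm_cast)
  obtain ⟨W, hWs, hcl, hpos, ⟨A, a, ha, henv⟩, M, hterm⟩ :=
    blockSolver_limit ν B s₀ tₘ s' b f hν hB h₀ₘ hₘs' hsm' hdiv' hBd' hf2 hfc hf0
  have hI : Ico s s' ⊆ Ioo tₘ s' := fun t ht => ⟨hₘs.trans_le ht.1, ht.2⟩
  have hO : IsOpen (Ioo tₘ s' ×ˢ (univ : Set (EuclideanSpace ℝ (Fin 3)))) :=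
    isOpen_Ioo.prod isOpen_univ
  refine ⟨W, (hWs.of_le (by norm_cast)).mono (prod_mono hI Subset.rfl), fun τ hτ x => ?_,
    fun τ hτ x => hpos τ (hI hτ) x, ⟨A, a, ha, fun τ hτ x => henv τ (hI hτ) x⟩, fun ε hε => ?_⟩
  · -- the one-sided time derivative within `Ico s s'` is the two-sided one
    have hτO : τ ∈ Ioo tₘ s' := hI hτ
    have hd : HasFDerivAt (uncurry W) (fderiv ℝ (uncurry W) (τ, x)) (τ, x) :=
      ((hWs.differentiableOn (by simp)).differentiableAt (hO.mem_nhds ⟨hτO, mem_univ x⟩)).hasFDerivAt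
    have htl := hasDerivAt_timeLine hd
    rw [timeDerivWithin_apply, htl.hasDerivWithinAt.derivWithin (uniqueDiffOn_Ico s s' τ hτ),
      ← htl.deriv]
    exact hcl τ hτO x
  · -- terminal attainment: `|W − f| ≤ |W − F| + |F − f| ≤ (|M| + 3|C₂|ν)(s' − τ)`
    obtain ⟨C₀, C₁, C₂, hC₀, hC₁, hC₂⟩ := caloric_data_bounds hf2 hfc
    set K : ℝ := |M| + 3 * |C₂| * ν + 1 with hK
    have hK0 : 0 < K := by rw [hK]; positivity
    have hKne : K ≠ 0 := hK0.ne'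
    set s₂ : ℝ := max s (s' - ε / K) with hs₂
    have hs₂s : s ≤ s₂ := le_max_left _ _
    have hs₂' : s₂ < s' := max_lt hss' (by have := div_pos hε hK0; linarith)
    refine ⟨s₂, ⟨hs₂s, hs₂'⟩, fun τ hτ x => ?_⟩
    have hτ' : τ < s' := hτ.2
    have hτO : τ ∈ Ioo tₘ s' := ⟨hₘs.trans_le (hs₂s.trans hτ.1), hτ'⟩
    have hgap : s' - τ ≤ ε / K := by
      have : s' - ε / K ≤ τ := (le_max_right _ _).trans hτ.1
      linarith
    have hgap0 : 0 ≤ s' - τ := by linarith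
    have h1 : |W τ x - heatExtension f (ν * (s' - τ)) x| ≤ |M| * (s' - τ) :=
      (hterm τ hτO x).trans (mul_le_mul_of_nonneg_right (le_abs_self M) hgap0)
    have h2 : |heatExtension f (ν * (s' - τ)) x - f x| ≤ 3 * |C₂| * (ν * (s' - τ)) := by
      have h := caloric_abs_sub_data_le (F := fun t y => heatExtension f (ν * (s' - t)) y) hν hf2
        rfl hC₀ hC₁ hC₂ hτ' x
      refine h.trans (mul_le_mul_of_nonneg_right ?_ (mul_nonneg hν.le hgap0))
      exact mul_le_mul_of_nonneg_left (le_abs_self C₂) (by norm_num)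
    calc |W τ x - f x|
        ≤ |W τ x - heatExtension f (ν * (s' - τ)) x| +
            |heatExtension f (ν * (s' - τ)) x - f x| := abs_sub_le _ _ _
      _ ≤ |M| * (s' - τ) + 3 * |C₂| * (ν * (s' - τ)) := add_le_add h1 h2
      _ = (K - 1) * (s' - τ) := by rw [hK]; ring
      _ ≤ (K - 1) * (ε / K) := mul_le_mul_of_nonneg_left hgap (by
          rw [hK]; linarith [abs_nonneg M, mul_nonneg (abs_nonneg C₂) hν.le])
      _ = ε - ε / K := by field_simp
      _ ≤ ε := by linarith [div_pos hε hK0]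

end Summit.NavierStokesRegularity.NavierStokesRegularity.Theorems.AdaptedFrequencyConverges.CloudFrameEffectiveTsai

end
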